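/-
Copyright: lit-balaban cell, Phase-2 proof seat p11 (gen 4).  Statement-level skeleton of a published paper; no proof claims beyond
what the kernel checks below.
-/
import Literature.MathematicalPhysics.QuantumFieldTheory.BalabanImbrieJaffe1984to88.BIJ85BlockAveragingIneq

/-!
# `BalabanImbrieJaffe1984to88.BIJ85BlockAveragingIneqCov` — T. Bałaban, J. Imbrie, A. Jaffe, *Renormalization of the Higgs model:
minimizers, propagators and the stability of mean field theory*, Commun. Math. Phys. **97** (1985) 299–329
[BalabanImbrieJaffe1985]: the COVARIANT block-averaging inequality at a GENERAL background `u` — the unit-lattice covariant bond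
form of the `k`-fold covariant average `Q_k(u)φ` (2.6)/(4.6.2) is bounded by `2(n²/N)·‖D_uφ‖²` PLUS an explicit HOLONOMY-DEFECT term
(the holonomies of `u` around the closed contours of (2.10) at level `k`); theorems only.  File 3 of the flat-background member of
SKELETON row **C1.Eq7.3.1-7.3.2** (files 1/2: `BIJ85BlockAveragingIneq`, `BIJ85Ineq732Flat`): it ISOLATES the term through which the
hypothesis (7.3.1) has to enter a proof of (7.3.2) at a general background, and proves nothing about its size.

statement-level skeleton of published theorems with citation tags; proofs where landed; nothing here is a claim about the Yang–Mills mass gap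

PDF held: `paper:balaban1985-cmp97-bij-higgs-minimizers` (journal page = PDF page + 298).  Pages read: p. 302–303 [PDF 4–5], p. 326 [PDF 28].

CITATION HEADER (lean-in-tree rule).  Phase-2 file of the lit-balaban TYPED SKELETON (HOME `run/shared/lean/pub/lit-balaban/`), seat
p11 gen 4 (unit `lit-balaban-p11-g4`; TAKING line HOME/STATUS.md 2026-08-21T06:04:48Z; owner r15, referee ref-5).  Carriers of record
only (BY NAME: `Balaban1983to89.Site/PBond/GaugeField`, r18's `runSite`/`runBond`, gen 3's `runProd` = the run transport (2.5),
`holCK` = `u(Γ^{(k)}_{yx})`, `blkIter`/`blockK`, `qCovK` = `Q_k(u)`).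

THE PRINTED TEXT, verbatim.  p. 303 [PDF 5]: *"(Qu)_{yy′} = u(Γ_{yy′}) exp[L^{−d}Σ_{x∈B(y)} ln u(Γ_{yx} ∘ Γ_{xx′} ∘ Γ_{y′x′}^{−1} ∘ Γ_{y′y})]
(2.10), x − x′ = y − y′"* (the closed contours); p. 326 [PDF 28]: *"let us assume that for the unit lattice field v, |v(∂p) − 1| ≤
e_k𝓅(e_k), (7.3.1) … ⟨φ, Δ_k(u_k)φ⟩ ≥ γ Σ_{b∈T₁^{(k)}} |u_k(b)φ(b₊) − φ(b₋)|² − Me_k^{2−α} Σ_{x∈T₁^{(k)}} |φ(x)|². (7.3.2) … These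
inequalities can be proved by an extension of the proofs of [7]."*

WHAT IS PROVED (0 `sorry`, standard axioms; no `def`).
* `norm_runProd_mul_sub_le` / `norm_runProd_mul_sub_sq_le`: COVARIANT TELESCOPING along the straight run of `n` bonds,
  `|u(run)φ(x + ne_μ) − φ(x)|² ≤ n·Σ_{t<n} |u(b_t)φ(x + (t+1)e_μ) − φ(x + te_μ)|²`.
* **`sum_norm_qCovK_shift_sub_sq_le_cov`**: for every `U(1)` field `u` on `T_η`, every unit field `W` on the bonds of `T₁^{(k)}`
  (`W` = the `u_k(b)` of the first printed form, or `v_b` of the second), every `φ : T_η → ℂ`, `j + k ≤ m + K`: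
  `Σ_{y,μ} |W(⟨y,y+e_μ⟩)(Q_k(u)φ)(y+e_μ) − (Q_k(u)φ)(y)|² ≤ 2(n²/N)·Σ_{b⊂T_η} |u_bφ(b₊) − φ(b₋)|² + 2N^{−1}·Σ_{x∈T_η} Σ_μ |ρ_μ(x) − 1|²·|φ(x+ne_μ)|²`
  with `n = L^k`, `N = L^{kd}` and `ρ_μ(x) = u(Γ^{(k)}_x)^{−1}·W(⟨x_k, x_k+e_μ⟩)·u(Γ^{(k)}_{x+ne_μ})·u(run_{x,μ,n})^{−1}` = the holonomy of
  `u` (with `W` standing in for the coarse-bond transport) around the closed contour of (2.10) at level `k`.  At `u = 1`, `W = 1` every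
  `ρ = 1` and this is `BIJ85BlockAveragingIneq.sum_norm_qCovK_one_shift_sub_sq_le` up to the factor `2`.
HONEST SCOPE.  This is bookkeeping: the defect term is quadratic in `φ` on the `η`-lattice, so to land it on the unit-lattice `Σ|ψ(x)|²` of
(7.3.2) one needs `max|ρ − 1|` small (from (7.3.1) and the structure (4.5.4) of `u_k`) AND a `u`-uniform bound on the minimizer
`φ_k = a_kG_k(u_k)Q_k^*ψ` — the unprinted *"extension of the proofs of [7]"*; neither is claimed here (HOME/GAPS.md G-C1-05).
-/

open scoped BigOperators
open Finset

namespace Literature.MathematicalPhysics.QuantumFieldTheory.BalabanImbrieJaffe1984to88.BIJ85BlockAveragingIneqCov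

open Literature.MathematicalPhysics.QuantumFieldTheory.Balaban1983to89
open BIJ88Sect3Statements (U1 toC toC_one toC_mul norm_toC)
open BIJ85Sect1Model (HiggsField)
open BIJ85BlockAveragesTorus BIJ85BlockAveragesTorusK BIJ85BlockAveragingIneq

noncomputable section

variable {P : Params} {j : ℕ}

/-- `|a + b|² ≤ 2|a|² + 2|b|²`. [folklore] -/
private theorem norm_add_sq_le_two' (a b : ℂ) : ‖a + b‖ ^ 2 ≤ 2 * ‖a‖ ^ 2 + 2 * ‖b‖ ^ 2 := by
  have h1 : ‖a + b‖ ^ 2 ≤ (‖a‖ + ‖b‖) ^ 2 := pow_le_pow_left₀ (norm_nonneg _) (norm_add_le a b) 2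
  nlinarith [sq_nonneg (‖a‖ - ‖b‖)]

/-- Jensen / Cauchy–Schwarz on a finite set: `|Σ_{x∈S} a_x|² ≤ |S|·Σ_{x∈S}|a_x|²`. [folklore] -/
private theorem norm_sum_sq_le_card_mul {ι : Type*} (S : Finset ι) (a : ι → ℂ) :
    ‖∑ x ∈ S, a x‖ ^ 2 ≤ S.card * ∑ x ∈ S, ‖a x‖ ^ 2 :=
  calc ‖∑ x ∈ S, a x‖ ^ 2 ≤ (∑ x ∈ S, ‖a x‖) ^ 2 := pow_le_pow_left₀ (norm_nonneg _) (norm_sum_le _ _) 2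
    _ ≤ S.card * ∑ x ∈ S, ‖a x‖ ^ 2 := sq_sum_le_card_mul_sum_sq

/-- Sums over the torus are invariant under the translation `x ↦ x + ne_μ` (a bijection of the finite torus). [folklore] -/
private theorem sum_runSite_eq' {α : Type*} [AddCommMonoid α] (μ : Fin P.d) (n : ℕ) (F : Balaban1983to89.Site P j → α) :
    ∑ x : Balaban1983to89.Site P j, F (runSite x μ n) = ∑ x : Balaban1983to89.Site P j, F x := by
  refine Fintype.sum_bijective _ (Finite.injective_iff_bijective.1 fun x y h => ?_) _ _ fun _ => rfl
  funext κ
  have hκ := congrFun h κ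
  by_cases e : κ = μ
  · subst e
    simpa only [runSite, Function.update_self, add_left_inj] using hκ
  · simpa only [runSite, Function.update_of_ne e] using hκ

/-- kernel (counting): `Σ_y Σ_μ Σ_{x∈B^k(y)} Σ_{t<n} F_μ(x + te_μ) = n·Σ_x Σ_μ F_μ(x)` (blocks partition the torus; each translation is a
bijection). [folklore] -/
private theorem sum_blocks_runs' {k : ℕ} (n : ℕ) (F : Fin P.d → Balaban1983to89.Site P j → ℝ) :
    ∑ y : Balaban1983to89.Site P (j+k), ∑ μ : Fin P.d, ∑ x ∈ blockK k y, ∑ t ∈ range n, F μ (runSite x μ t)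
      = n * ∑ x : Balaban1983to89.Site P j, ∑ μ : Fin P.d, F μ x := by
  rw [sum_comm, sum_comm (s := (univ : Finset (Balaban1983to89.Site P j))), mul_sum]
  refine sum_congr rfl fun μ _ => ?_
  rw [sum_blockK_sum (k := k) (fun x => ∑ t ∈ range n, F μ (runSite x μ t)), sum_comm,
    sum_congr rfl fun t _ => sum_runSite_eq' μ t (F μ), sum_const, card_range, nsmul_eq_mul]

/-! ## The covariant block-averaging inequality with holonomy defect -/

/-- kernel: COVARIANT TELESCOPING along the straight run of `n` bonds from `x` in direction `μ`:
`|(Π_{t<n} u(b_t))·φ(x + ne_μ) − φ(x)| ≤ Σ_{t<n} |u(b_t)φ(x + (t+1)e_μ) − φ(x + te_μ)|` (`|u(b_t)| = 1`; (2.5) for the run).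
[cite: BalabanImbrieJaffe1985, (2.5) p.302] -/
theorem norm_runProd_mul_sub_le (U : GaugeField P j U1) (φ : Balaban1983to89.Site P j → ℂ) (x : Balaban1983to89.Site P j)
    (μ : Fin P.d) : ∀ n : ℕ,
    ‖toC (runProd U x μ n) * φ (runSite x μ n) - φ x‖
      ≤ ∑ t ∈ range n, ‖toC (U (runBond x μ t)) * φ ((runSite x μ t).shift μ) - φ (runSite x μ t)‖
  | 0 => by rw [runProd, toC_one, one_mul, runSite_zero, sub_self, norm_zero, sum_range_zero]
  | n + 1 => by
    have e : toC (runProd U x μ (n + 1)) * φ (runSite x μ (n + 1)) - φ x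
        = toC (runProd U x μ n) * (toC (U (runBond x μ n)) * φ ((runSite x μ n).shift μ) - φ (runSite x μ n))
          + (toC (runProd U x μ n) * φ (runSite x μ n) - φ x) := by
      rw [runProd, toC_mul, runSite_shift]; ring
    rw [e, sum_range_succ]
    refine (norm_add_le _ _).trans ?_
    rw [norm_mul, norm_toC, one_mul, add_comm]
    exact add_le_add (norm_runProd_mul_sub_le U φ x μ n) le_rfl

/-- kernel: the covariant telescoping bound squared, with Cauchy–Schwarz:
`|(Π_{t<n} u(b_t))·φ(x + ne_μ) − φ(x)|² ≤ n·Σ_{t<n} |u(b_t)φ(x + (t+1)e_μ) − φ(x + te_μ)|²`. [cite: BalabanImbrieJaffe1985, (2.5) p.302] -/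
theorem norm_runProd_mul_sub_sq_le (U : GaugeField P j U1) (φ : Balaban1983to89.Site P j → ℂ) (x : Balaban1983to89.Site P j)
    (μ : Fin P.d) (n : ℕ) :
    ‖toC (runProd U x μ n) * φ (runSite x μ n) - φ x‖ ^ 2
      ≤ n * ∑ t ∈ range n, ‖toC (U (runBond x μ t)) * φ ((runSite x μ t).shift μ) - φ (runSite x μ t)‖ ^ 2 := by
  have h1 := pow_le_pow_left₀ (norm_nonneg _) (norm_runProd_mul_sub_le U φ x μ n) 2
  refine h1.trans ?_
  have h2 := sq_sum_le_card_mul_sum_sq (s := range n)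
    (f := fun t => ‖toC (U (runBond x μ t)) * φ ((runSite x μ t).shift μ) - φ (runSite x μ t)‖)
  rwa [card_range] at h2

/-- kernel (one term): with `h = u(Γ^{(k)}_{·})` the composite transports, `W` a unit number on the coarse bond, `r` the run transport and
`ρ := h(x)^{−1}·W·h(x′)·r^{−1}` the HOLONOMY DEFECT of the closed contour (`x′ = x + L^ke_μ`; the loop of (2.10) at level `k`):
`|W·h(x′)φ(x′) − h(x)φ(x)|² ≤ 2|r·φ(x′) − φ(x)|² + 2|ρ − 1|²|φ(x′)|²` (`|h| = |W| = |r| = 1`). [cite: BalabanImbrieJaffe1985, (2.10) p.303] -/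
private theorem norm_defect_term_sq_le {h h' W r φ' φ0 : ℂ} (hh : ‖h‖ = 1) (hr : ‖r‖ = 1) :
    ‖W * (h' * φ') - h * φ0‖ ^ 2 ≤ 2 * ‖r * φ' - φ0‖ ^ 2 + 2 * (‖h⁻¹ * W * h' * r⁻¹ - 1‖ ^ 2 * ‖φ'‖ ^ 2) := by
  have hne : h ≠ 0 := fun e => by simp [e] at hh
  have rne : r ≠ 0 := fun e => by simp [e] at hr
  have e1 : W * (h' * φ') - h * φ0 = h * ((r * φ' - φ0) + (h⁻¹ * W * h' * r⁻¹ - 1) * (r * φ')) := by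
    field_simp
    ring
  rw [e1, norm_mul, hh, one_mul]
  refine (norm_add_sq_le_two' _ _).trans ?_
  rw [norm_mul, norm_mul, hr, one_mul, mul_pow]

/-- **THE COVARIANT BLOCK-AVERAGING INEQUALITY WITH HOLONOMY DEFECT** (general background `u`, any unit field `W` on the bonds of
`T₁^{(k)}`, standing range): for every `φ : T_η → ℂ`,
`Σ_{y,μ} |W(⟨y,y+e_μ⟩)(Q_k(u)φ)(y+e_μ) − (Q_k(u)φ)(y)|² ≤ 2(n²/N)·Σ_{b⊂T_η}|u_bφ(b₊) − φ(b₋)|² + 2N^{−1}·Σ_{x∈T_η}Σ_μ |ρ_μ(x) − 1|²|φ(x + ne_μ)|²`,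
`n = L^k`, `N = L^{kd}`, where `ρ_μ(x) = u(Γ^{(k)}_{x})^{−1}·W(⟨x_k, x_k+e_μ⟩)·u(Γ^{(k)}_{x+ne_μ})·u(run_{x,μ,n})^{−1}` is the holonomy of `u` (with `W`
standing in for the coarse-bond transport) around the closed contour `Γ^{(k)}_{x_k x} ∘ ⟨x, x+ne_μ⟩ ∘ (Γ^{(k)}_{x_k+e_μ, x+ne_μ})^{−1} ∘ ⟨x_k+e_μ, x_k⟩`
— the loop of (2.10) at level `k`.  At a flat `u` with `W` = the coarse-bond transport every `ρ = 1` and the defect term vanishes; at a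
general `u_k` this is the term that (7.3.1) must control (HONEST SCOPE of `BIJ85Ineq732Flat`: not done here).
[cite: BalabanImbrieJaffe1985, (7.3.2) p.326] -/
theorem sum_norm_qCovK_shift_sub_sq_le_cov {k : ℕ} (hk : j + k ≤ P.m + P.K) (U : GaugeField P j U1) (W : GaugeField P (j+k) U1)
    (φ : HiggsField P j) :
    ∑ y : Balaban1983to89.Site P (j+k), ∑ μ : Fin P.d,
        ‖toC (W ⟨y, μ⟩) * qCovK U k φ (y.shift μ) - qCovK U k φ y‖ ^ 2
      ≤ 2 * (((P.L : ℝ) ^ k) ^ 2 / (P.L : ℝ) ^ (k * P.d)) * ∑ b : PBond P j, ‖toC (U b) * φ b.tgt - φ b.src‖ ^ 2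
        + 2 * ((P.L : ℝ) ^ (k * P.d))⁻¹ * ∑ x : Balaban1983to89.Site P j, ∑ μ : Fin P.d,
            ‖(holCK U k x)⁻¹ * toC (W ⟨blkIter k x, μ⟩) * holCK U k (runSite x μ (P.L ^ k))
                * (toC (runProd U x μ (P.L ^ k)))⁻¹ - 1‖ ^ 2 * ‖φ (runSite x μ (P.L ^ k))‖ ^ 2 := by
  set n : ℕ := P.L ^ k with hn
  set N : ℝ := (P.L : ℝ) ^ (k * P.d) with hN
  have hNpos : 0 < N := pow_pos (Nat.cast_pos.2 P.L_pos) _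
  -- the fine kinetic integrand and the defect integrand
  set F : Fin P.d → Balaban1983to89.Site P j → ℝ :=
    fun μ z => ‖toC (U ⟨z, μ⟩) * φ (z.shift μ) - φ z‖ ^ 2 with hF
  set Dft : Fin P.d → Balaban1983to89.Site P j → ℝ := fun μ x =>
    ‖(holCK U k x)⁻¹ * toC (W ⟨blkIter k x, μ⟩) * holCK U k (runSite x μ n) * (toC (runProd U x μ n))⁻¹ - 1‖ ^ 2
      * ‖φ (runSite x μ n)‖ ^ 2 with hDft
  -- one coarse bond
  have hB : ∀ (y : Balaban1983to89.Site P (j+k)) (μ : Fin P.d),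
      ‖toC (W ⟨y, μ⟩) * qCovK U k φ (y.shift μ) - qCovK U k φ y‖ ^ 2
        ≤ N⁻¹ * ∑ x ∈ blockK k y, (2 * ((n : ℝ) * ∑ t ∈ range n, F μ (runSite x μ t)) + 2 * Dft μ x) := by
    intro y μ
    rw [qCovK_apply, qCovK_apply, sum_blockK_shift hk, ← mul_assoc, mul_comm (toC (W ⟨y, μ⟩)), mul_assoc, ← mul_sub, mul_sum,
      ← sum_sub_distrib, norm_mul, mul_pow, norm_inv, norm_pow, Complex.norm_natCast, Nat.cast_pow]
    have h1 := norm_sum_sq_le_card_mul (blockK k y)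
      (fun x => toC (W ⟨y, μ⟩) * (holCK U k (runSite x μ n) * φ (runSite x μ n)) - holCK U k x * φ x)
    rw [card_blockK k hk y, Nat.cast_pow] at h1
    have h2 : ∑ x ∈ blockK k y, ‖toC (W ⟨y, μ⟩) * (holCK U k (runSite x μ n) * φ (runSite x μ n)) - holCK U k x * φ x‖ ^ 2
        ≤ ∑ x ∈ blockK k y, (2 * ((n : ℝ) * ∑ t ∈ range n, F μ (runSite x μ t)) + 2 * Dft μ x) := by
      refine sum_le_sum fun x hx => ?_
      have hy : blkIter k x = y := mem_blockK.1 hx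
      have h3 := norm_defect_term_sq_le (h' := holCK U k (runSite x μ n)) (W := toC (W ⟨y, μ⟩))
        (φ' := φ (runSite x μ n)) (φ0 := φ x) (norm_holCK U k x) (norm_toC (runProd U x μ n))
      refine h3.trans (add_le_add ?_ ?_)
      · refine mul_le_mul_of_nonneg_left ?_ (by norm_num)
        have h4 := norm_runProd_mul_sub_sq_le U φ x μ n
        exact h4
      · simp only [hDft, hy, le_refl]
    have h12 := h1.trans (mul_le_mul_of_nonneg_left h2 hNpos.le)
    refine (mul_le_mul_of_nonneg_left h12 (by positivity)).trans (le_of_eq ?_)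
    rw [pow_two, mul_assoc, ← mul_assoc N⁻¹ N, inv_mul_cancel₀ hNpos.ne', one_mul]
    simp only [hN, hn, Nat.cast_pow]
  -- sum over the coarse bonds
  have key := sum_blocks_runs' (k := k) n F
  calc ∑ y : Balaban1983to89.Site P (j+k), ∑ μ : Fin P.d, ‖toC (W ⟨y, μ⟩) * qCovK U k φ (y.shift μ) - qCovK U k φ y‖ ^ 2
      ≤ ∑ y : Balaban1983to89.Site P (j+k), ∑ μ : Fin P.d,
          N⁻¹ * ∑ x ∈ blockK k y, (2 * ((n : ℝ) * ∑ t ∈ range n, F μ (runSite x μ t)) + 2 * Dft μ x) :=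
        sum_le_sum fun y _ => sum_le_sum fun μ _ => hB y μ
    _ = N⁻¹ * (2 * (n : ℝ) * ∑ y : Balaban1983to89.Site P (j+k), ∑ μ : Fin P.d, ∑ x ∈ blockK k y, ∑ t ∈ range n, F μ (runSite x μ t)
          + 2 * ∑ y : Balaban1983to89.Site P (j+k), ∑ μ : Fin P.d, ∑ x ∈ blockK k y, Dft μ x) := by
        simp_rw [← mul_sum, sum_add_distrib, ← mul_sum, mul_sum, ← mul_assoc]
    _ = N⁻¹ * (2 * (n : ℝ) * ((n : ℝ) * ∑ x : Balaban1983to89.Site P j, ∑ μ : Fin P.d, F μ x)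
          + 2 * ∑ x : Balaban1983to89.Site P j, ∑ μ : Fin P.d, Dft μ x) := by
        have hD : ∑ y : Balaban1983to89.Site P (j+k), ∑ μ : Fin P.d, ∑ x ∈ blockK k y, Dft μ x
            = ∑ x : Balaban1983to89.Site P j, ∑ μ : Fin P.d, Dft μ x :=
          calc ∑ y : Balaban1983to89.Site P (j+k), ∑ μ : Fin P.d, ∑ x ∈ blockK k y, Dft μ x
              = ∑ μ : Fin P.d, ∑ y : Balaban1983to89.Site P (j+k), ∑ x ∈ blockK k y, Dft μ x := sum_comm
            _ = ∑ μ : Fin P.d, ∑ x : Balaban1983to89.Site P j, Dft μ x :=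
                sum_congr rfl fun μ _ => sum_blockK_sum (k := k) (Dft μ)
            _ = ∑ x : Balaban1983to89.Site P j, ∑ μ : Fin P.d, Dft μ x := sum_comm
        rw [key, hD]
    _ = _ := by
        rw [sum_bond_eq, hN, hn]
        push_cast
        simp only [hF, hDft, PBond.tgt]
        ring

end

end Literature.MathematicalPhysics.QuantumFieldTheory.BalabanImbrieJaffe1984to88.BIJ85BlockAveragingIneqCov
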